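import Summits.Ventures.HodgeRepro.Faces

/-!
# Stabilisers of type squares under the Galois twists — for EVERY finite `(G, c)` (seat `p1`, gen 4)

Blind re-derivation cell `pub-hodge-repro`.  On the `typer` vocabulary (`IsComplexConj`, `IsCMType`, `place`,
`flipAt`, `rmul`): the *type square* of a face `(Φ; p, p')` is `{Φ, Φ^{(p)}, Φ^{(p')}, Φ^{(p p')}}` and the Galois
twist `Ψ ↦ Ψ·g` (`rmul`) acts on squares.  The sealed census counts the orbits of squares (`1`; `3, 4, 4, 6, 5, 3`;
`20, 22, 26, 20`) and their sizes.  This file proves the STRUCTURAL statement behind those numbers for every finite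
group `G` with complex conjugation `c` and every CM type, as soon as there are at least three places:

* `eq_one_or_involution_of_fix`: a twist `g` fixing a type square is the identity, or an involution `g ≠ c` that
  swaps the two places of the square (`c` itself fixes no square; `g² = c` is impossible);
* `fix_unique` / `card_stabilizer_le_two`: the stabiliser of a square has at most two elements.

Consequently (orbit–stabiliser) every orbit of squares has size `|G|` or `|G|/2`; the per-row kernel certificates
`FaceOrbitRows*.lean` verify this and the full Burnside count on the eleven sealed tables.  Paper proof: `proofs/P1.md` §8.
-/

open Finset

namespace HodgeRepro.TwistOrbit

variable {G : Type*} [Group G] [DecidableEq G]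

/-- The type square of the face `(Φ; p, p')`: the four CM types `Φ, Φ^{(p)}, Φ^{(p')}, Φ^{(p p')}`. -/
def typeSquare (c : G) (Φ : Finset G) (p p' : G) : Finset (Finset G) :=
  {Φ, flipAt c p Φ, flipAt c p' Φ, flipAt c p' (flipAt c p Φ)}

/-- The Galois twist `Ψ ↦ Ψ·h` applied to a set of types. -/
def rmulSet (S : Finset (Finset G)) (h : G) : Finset (Finset G) := S.image fun Ψ => rmul Ψ h

/-- `Φ` is a corner of its own square. -/
theorem self_mem_typeSquare (c : G) (Φ : Finset G) (p p' : G) : Φ ∈ typeSquare c Φ p p' := by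
  simp [typeSquare]

/-- `Φ^{(p)}` is a corner of the square. -/
theorem flipAt_mem_typeSquare (c : G) (Φ : Finset G) (p p' : G) : flipAt c p Φ ∈ typeSquare c Φ p p' := by
  simp [typeSquare]

/-- The square does not depend on the order of the two places. -/
theorem typeSquare_comm (c : G) (Φ : Finset G) (p p' : G) : typeSquare c Φ p p' = typeSquare c Φ p' p := by
  ext Ψ
  simp only [typeSquare, mem_insert, mem_singleton, flipAt_comm c p p']
  tauto

/-- The twist of a member of `S` lies in the twist of `S`. -/
theorem rmul_mem_rmulSet {S : Finset (Finset G)} {h : G} {Ψ : Finset G} (hΨ : Ψ ∈ S) :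
    rmul Ψ h ∈ rmulSet S h :=
  mem_image_of_mem _ hΨ

/-- Twisting twice is twisting by the product. -/
theorem rmulSet_rmulSet (S : Finset (Finset G)) (h k : G) : rmulSet (rmulSet S h) k = rmulSet S (h * k) := by
  unfold rmulSet
  rw [image_image]
  congr 1
  funext Ψ
  exact rmul_rmul Ψ h k

/-- Outside the two places of the square, every corner agrees with `Φ`. -/
theorem mem_iff_of_mem_typeSquare {c : G} {Φ : Finset G} {p p' : G} {Ψ : Finset G}
    (hΨ : Ψ ∈ typeSquare c Φ p p') {x : G} (hx : x ∉ place c p) (hx' : x ∉ place c p') :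
    x ∈ Ψ ↔ x ∈ Φ := by
  simp only [typeSquare, mem_insert, mem_singleton] at hΨ
  rcases hΨ with rfl | rfl | rfl | rfl
  · exact Iff.rfl
  · rw [mem_flipAt]; tauto
  · rw [mem_flipAt]; tauto
  · rw [mem_flipAt, mem_flipAt]; tauto

/-! ### Places -/

/-- `p·h` lies in the place of `p` iff `h` is the identity or complex conjugation. -/
theorem mul_mem_place_self_iff {c : G} (hc : IsComplexConj c) {p h : G} :
    p * h ∈ place c p ↔ h = 1 ∨ h = c := by
  rw [mem_place]
  constructor
  · rintro (e | e)
    · left; exact mul_left_cancel (e.trans (mul_one p).symm)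
    · right; rw [hc.comm] at e; exact mul_left_cancel e
  · rintro (rfl | rfl)
    · left; exact mul_one p
    · right; exact (hc.comm p).symm

/-- Membership in a place is symmetric. -/
theorem mem_place_comm {c : G} (hc : IsComplexConj c) {p p' : G} : p ∈ place c p' ↔ p' ∈ place c p := by
  simp only [mem_place]
  constructor
  · rintro (rfl | rfl)
    · left; rfl
    · right; rw [hc.mul_mul_cancel]
  · rintro (rfl | rfl)
    · left; rfl
    · right; rw [hc.mul_mul_cancel]

/-- Right translation maps places to places: `x ∈ {y, c y} ↔ x h ∈ {y h, c y h}`. -/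
theorem mul_mem_place_mul_iff {c : G} {x y h : G} : x * h ∈ place c (y * h) ↔ x ∈ place c y := by
  simp only [mem_place, ← mul_assoc]
  constructor
  · rintro (e | e)
    · left; exact mul_right_cancel e
    · right; exact mul_right_cancel e
  · rintro (rfl | rfl)
    · left; rfl
    · right; rfl

/-- The place of a member of a place is that place. -/
theorem place_eq_of_mem {c : G} (hc : IsComplexConj c) {a b : G} (h : a ∈ place c b) : place c a = place c b := by
  rw [mem_place] at h
  rcases h with rfl | rfl
  · rfl
  · ext x
    simp only [mem_place, hc.mul_mul_cancel]
    tauto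

/-! ### The stabiliser of a square -/

/-- If the twist by `g` fixes the square of `(Φ; p, p')`, then `p·g` lies in one of its two places. -/
theorem mul_mem_or_of_fix {c : G} {Φ : Finset G} {p p' g : G}
    (h : rmulSet (typeSquare c Φ p p') g = typeSquare c Φ p p') :
    p * g ∈ place c p ∨ p * g ∈ place c p' := by
  by_contra hcon
  rw [not_or] at hcon
  have h1 : rmul Φ g ∈ typeSquare c Φ p p' := by
    rw [← h]; exact rmul_mem_rmulSet (self_mem_typeSquare c Φ p p')
  have h2 : rmul (flipAt c p Φ) g ∈ typeSquare c Φ p p' := by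
    rw [← h]; exact rmul_mem_rmulSet (flipAt_mem_typeSquare c Φ p p')
  have e1 := mem_iff_of_mem_typeSquare h1 hcon.1 hcon.2
  have e2 := mem_iff_of_mem_typeSquare h2 hcon.1 hcon.2
  rw [mem_rmul, mul_inv_cancel_right] at e1 e2
  rw [mem_flipAt] at e2
  have hp : p ∈ place c p := mem_place_self c p
  tauto

/-- A twist fixing a square agrees with the identity on `Φ` outside the two places: `x g⁻¹ ∈ Φ ↔ x ∈ Φ`. -/
theorem mem_rmul_iff_of_fix {c : G} {Φ : Finset G} {p p' g : G}
    (h : rmulSet (typeSquare c Φ p p') g = typeSquare c Φ p p') {x : G}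
    (hx : x ∉ place c p) (hx' : x ∉ place c p') : x * g⁻¹ ∈ Φ ↔ x ∈ Φ := by
  have h1 : rmul Φ g ∈ typeSquare c Φ p p' := by
    rw [← h]; exact rmul_mem_rmulSet (self_mem_typeSquare c Φ p p')
  have := mem_iff_of_mem_typeSquare h1 hx hx'
  rwa [mem_rmul] at this

omit [DecidableEq G] in
/-- No CM type contains an element together with its conjugate: `x ∈ Φ → c x ∉ Φ`. -/
theorem not_conj_mem_of_mem {c : G} {Φ : Finset G} (hΦ : IsCMType c Φ) {x : G} (hx : x ∈ Φ) : c * x ∉ Φ :=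
  (hΦ x).1 hx

/-- Given a third place, pick an element of `Φ` outside the two places of the square. -/
theorem exists_mem_outside {c : G} (hc : IsComplexConj c) {Φ : Finset G} (hΦ : IsCMType c Φ) {p p' : G}
    (hq : ∃ q, q ∉ place c p ∧ q ∉ place c p') : ∃ x, x ∈ Φ ∧ x ∉ place c p ∧ x ∉ place c p' := by
  obtain ⟨q, hq1, hq2⟩ := hq
  rcases hΦ.mem_or_conj_mem q with hx | hx
  · exact ⟨q, hx, hq1, hq2⟩
  · refine ⟨c * q, hx, ?_, ?_⟩
    · rwa [conj_mem_place_iff hc]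
    · rwa [conj_mem_place_iff hc]

/-- Complex conjugation fixes no square (once a third place exists). -/
theorem not_fix_conj {c : G} (hc : IsComplexConj c) {Φ : Finset G} (hΦ : IsCMType c Φ) {p p' : G}
    (hq : ∃ q, q ∉ place c p ∧ q ∉ place c p') :
    rmulSet (typeSquare c Φ p p') c ≠ typeSquare c Φ p p' := by
  intro h
  obtain ⟨x, hxΦ, hx1, hx2⟩ := exists_mem_outside hc hΦ hq
  have e := mem_rmul_iff_of_fix h hx1 hx2
  rw [hc.inv_eq, ← hc.comm] at e
  exact not_conj_mem_of_mem hΦ hxΦ (e.2 hxΦ)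

/-- **Stabiliser lemma.** If the twist by `g` fixes the type square of `(Φ; p, p')` and a third place exists, then
`g = 1`, or `g` is an involution different from complex conjugation which swaps the two places of the square. -/
theorem eq_one_or_involution_of_fix {c : G} (hc : IsComplexConj c) {Φ : Finset G} (hΦ : IsCMType c Φ) {p p' : G}
    (hpp' : p' ∉ place c p) (hq : ∃ q, q ∉ place c p ∧ q ∉ place c p') {g : G}
    (h : rmulSet (typeSquare c Φ p p') g = typeSquare c Φ p p') :
    g = 1 ∨ (g * g = 1 ∧ g ≠ c ∧ p * g ∈ place c p' ∧ p' * g ∈ place c p) := by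
  have hA := mul_mem_or_of_fix h
  have h' : rmulSet (typeSquare c Φ p' p) g = typeSquare c Φ p' p := by rwa [← typeSquare_comm]
  have hB := mul_mem_or_of_fix h'
  have hp'p : p ∉ place c p' := fun e => hpp' ((mem_place_comm hc).1 e)
  rcases hA with hA | hA
  · -- `p g ∈ {p, c p}`: `g = 1` or `g = c`; the latter fixes no square
    rcases (mul_mem_place_self_iff hc).1 hA with rfl | rfl
    · exact Or.inl rfl
    · exact absurd h (not_fix_conj hc hΦ hq)
  · -- `p g ∈ {p', c p'}`: then `p' g ∈ {p, c p}` and `g² ∈ {1, c}`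
    have hB' : p' * g ∈ place c p := by
      rcases hB with hB | hB
      · rcases (mul_mem_place_self_iff hc).1 hB with rfl | rfl
        · rw [mul_one] at hA; exact absurd hA hp'p
        · rw [← hc.comm, conj_mem_place_iff hc] at hA; exact absurd hA hp'p
      · exact hB
    have hgg : p * (g * g) ∈ place c p := by
      rw [← mul_assoc]
      have : p * g * g ∈ place c (p' * g) := mul_mem_place_mul_iff.2 hA
      rwa [place_eq_of_mem hc hB'] at this
    have hgc : g ≠ c := by
      rintro rfl
      rw [← hc.comm, conj_mem_place_iff hc] at hA; exact hp'p hA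
    rcases (mul_mem_place_self_iff hc).1 hgg with hgg | hgg
    · exact Or.inr ⟨hgg, hgc, hA, hB'⟩
    · -- `g² = c`: the third place gives a contradiction
      exfalso
      obtain ⟨x, hxΦ, hx1, hx2⟩ := exists_mem_outside hc hΦ hq
      have hy1 : x * g⁻¹ ∉ place c p := by
        intro e
        have : x * g⁻¹ * g ∈ place c (p * g) := mul_mem_place_mul_iff.2 e
        rw [inv_mul_cancel_right, place_eq_of_mem hc hA] at this
        exact hx2 this
      have hy2 : x * g⁻¹ ∉ place c p' := by
        intro e
        have : x * g⁻¹ * g ∈ place c (p' * g) := mul_mem_place_mul_iff.2 e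
        rw [inv_mul_cancel_right, place_eq_of_mem hc hB'] at this
        exact hx1 this
      have e1 := mem_rmul_iff_of_fix h hx1 hx2
      have e2 := mem_rmul_iff_of_fix h hy1 hy2
      rw [mul_assoc, ← mul_inv_rev, hgg, hc.inv_eq, ← hc.comm] at e2
      exact not_conj_mem_of_mem hΦ hxΦ (e2.2 (e1.2 hxΦ))

/-- Two non-trivial twists fixing the same square coincide: the stabiliser has at most two elements. -/
theorem fix_unique {c : G} (hc : IsComplexConj c) {Φ : Finset G} (hΦ : IsCMType c Φ) {p p' : G}
    (hpp' : p' ∉ place c p) (hq : ∃ q, q ∉ place c p ∧ q ∉ place c p') {g g' : G}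
    (hg : rmulSet (typeSquare c Φ p p') g = typeSquare c Φ p p')
    (hg' : rmulSet (typeSquare c Φ p p') g' = typeSquare c Φ p p') (h1 : g ≠ 1) (h1' : g' ≠ 1) : g = g' := by
  rcases eq_one_or_involution_of_fix hc hΦ hpp' hq hg with e | ⟨hgg, -, hA, -⟩
  · exact absurd e h1
  rcases eq_one_or_involution_of_fix hc hΦ hpp' hq hg' with e | ⟨-, -, -, hB'⟩
  · exact absurd e h1'
  have hprod : p * (g * g') ∈ place c p := by
    rw [← mul_assoc]
    have : p * g * g' ∈ place c (p' * g') := mul_mem_place_mul_iff.2 hA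
    rwa [place_eq_of_mem hc hB'] at this
  rcases (mul_mem_place_self_iff hc).1 hprod with e | e
  · -- `g g' = 1` with `g² = 1` gives `g' = g`
    have : g * g' = g * g := e.trans hgg.symm
    exact (mul_left_cancel this).symm
  · -- `g g' = c` would make `c` fix the square
    exfalso
    have hfix : rmulSet (typeSquare c Φ p p') (g * g') = typeSquare c Φ p p' := by
      rw [← rmulSet_rmulSet, hg, hg']
    rw [e] at hfix
    exact not_fix_conj hc hΦ hq hfix

/-! ### Symmetric faces have an induced corner -/

/-- Two members of a CM type in one place coincide. -/
theorem eq_of_mem_place_of_isCMType {c : G} {Φ : Finset G} (hΦ : IsCMType c Φ) {x y : G} (hx : x ∈ Φ)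
    (hy : y ∈ Φ) (hyx : y ∈ place c x) : y = x := by
  rw [mem_place] at hyx
  rcases hyx with rfl | rfl
  · rfl
  · exact absurd hy (not_conj_mem_of_mem hΦ hx)

/-- A CM type meets every place. -/
theorem exists_mem_place_of_isCMType {c : G} {Φ : Finset G} (hΦ : IsCMType c Φ) (p : G) :
    ∃ a ∈ Φ, a ∈ place c p := by
  rcases hΦ.mem_or_conj_mem p with h | h
  · exact ⟨p, h, mem_place_self c p⟩
  · exact ⟨c * p, h, conj_mem_place c p⟩

/-- **Symmetric faces have an induced corner.** If a non-trivial twist `g` fixes the square of `(Φ; p, p')`, then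
some corner `Ψ` of the square is `g`-invariant, `Ψ·g = Ψ` — i.e. the CM type `Ψ` is induced from the index-two
CM subfield fixed by the involution `g`. -/
theorem exists_corner_rmul_eq_of_fix {c : G} (hc : IsComplexConj c) {Φ : Finset G} (hΦ : IsCMType c Φ)
    {p p' : G} (hpp' : p' ∉ place c p) (hq : ∃ q, q ∉ place c p ∧ q ∉ place c p') {g : G}
    (h : rmulSet (typeSquare c Φ p p') g = typeSquare c Φ p p') (h1 : g ≠ 1) :
    ∃ Ψ ∈ typeSquare c Φ p p', rmul Ψ g = Ψ := by
  rcases eq_one_or_involution_of_fix hc hΦ hpp' hq h with e | ⟨hgg, -, hA, hB'⟩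
  · exact absurd e h1
  have hginv : g⁻¹ = g := inv_eq_of_mul_eq_one_right hgg
  have hdisj : ∀ x, x ∈ place c p → x ∉ place c p' := fun x hx hx' =>
    disjoint_left.1 (disjoint_place hc hpp') hx hx'
  obtain ⟨a, haΦ, hap⟩ := exists_mem_place_of_isCMType hΦ p
  have hag : a * g ∈ place c p' := by
    rw [mem_place] at hap
    rcases hap with rfl | rfl
    · exact hA
    · rw [mul_assoc]; exact (conj_mem_place_iff hc).2 hA
  have hstar : ∀ x, x ∉ place c p → x ∉ place c p' → (x * g ∈ Φ ↔ x ∈ Φ) := by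
    intro x hx hx'
    have := mem_rmul_iff_of_fix h hx hx'
    rwa [hginv] at this
  have hout : ∀ x, x ∉ place c p → x ∉ place c p' → x * g ∉ place c p ∧ x * g ∉ place c p' := by
    intro x hx hx'
    constructor
    · intro e
      have : x * g * g ∈ place c (p * g) := mul_mem_place_mul_iff.2 e
      rw [mul_assoc, hgg, mul_one, place_eq_of_mem hc hA] at this
      exact hx' this
    · intro e
      have : x * g * g ∈ place c (p' * g) := mul_mem_place_mul_iff.2 e
      rw [mul_assoc, hgg, mul_one, place_eq_of_mem hc hB'] at this
      exact hx this
  -- any corner agreeing with `Φ` off the place of `p'` and containing `a g` is `g`-invariant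
  have main : ∀ Ψ, IsCMType c Ψ → (∀ x, x ∉ place c p' → (x ∈ Ψ ↔ x ∈ Φ)) → a * g ∈ Ψ → rmul Ψ g = Ψ := by
    intro Ψ hΨcm hΨout hagΨ
    have haΨ : a ∈ Ψ := (hΨout a (hdisj a hap)).2 haΦ
    have key : ∀ x, x ∈ Ψ → x * g ∈ Ψ := by
      intro x hx
      by_cases hxp : x ∈ place c p
      · have hxa : x = a :=
          eq_of_mem_place_of_isCMType hΨcm haΨ hx (by rwa [place_eq_of_mem hc hap])
        rw [hxa]; exact hagΨ
      · by_cases hxp' : x ∈ place c p'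
        · have hxag : x = a * g :=
            eq_of_mem_place_of_isCMType hΨcm hagΨ hx (by rwa [place_eq_of_mem hc hag])
          rw [hxag, mul_assoc, hgg, mul_one]; exact haΨ
        · have hxΦ : x ∈ Φ := (hΨout x hxp').1 hx
          have hxgΦ : x * g ∈ Φ := (hstar x hxp hxp').2 hxΦ
          exact (hΨout (x * g) (hout x hxp hxp').2).2 hxgΦ
    ext x
    rw [mem_rmul, hginv]
    constructor
    · intro hx
      have := key (x * g) hx
      rwa [mul_assoc, hgg, mul_one] at this
    · exact key x
  by_cases hcase : a * g ∈ Φ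
  · exact ⟨Φ, self_mem_typeSquare c Φ p p', main Φ hΦ (fun _ _ => Iff.rfl) hcase⟩
  · refine ⟨flipAt c p' Φ, by simp [typeSquare], main _ (hΦ.flipAt hc p') ?_ ?_⟩
    · intro x hx
      rw [mem_flipAt]; tauto
    · rw [mem_flipAt]; exact Or.inr ⟨hag, hcase⟩

end HodgeRepro.TwistOrbit
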